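import Summits.QuantumFields.YangMills.Theorems.CovariantDischargeOneLinkIncrement
import HarnessLib

/-!
# Line «covariant_discharge» on crux `HistoryTailL` (stmt-QuantumFields-19936) — the PLAQUETTE TRANSPORT FORMULA: the holonomy of a
# plaquette whose four letters are left-translated, and the per-plaquette cost/torque split of the Wilson action

Cell `ym3-torus` (YM ladder rung R3 = continuum SU(2) Yang–Mills on the three-torus — a RUNG, NOT the Clay problem), width seat
`ym-ust-19936-w3` gen 8, fifth helper brick (E-5) toward the sweep-gap hypothesis (HGap) of (E-3)
`CovariantDischargeSweepGapReduction.unboundedDepth_of_sweepGap`.  A sweep left-translates links `U_b ↦ h_b·U_b`; the Wilson action is a sum over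
PLAQUETTES, and the quadratic term `½β_K Σ_p (da)(p)²` of the card is a per-plaquette quantity.  THIS FILE is the per-plaquette bookkeeping:

* §1 (any gauge group, any level) ★`plaqHol_of_mul_left`: if `U′(bᵢ) = hᵢ·U(bᵢ)` on the four letters `b₁ b₂ b₃⁻¹ b₄⁻¹` of `∂p`, then
  `U′(∂p) = T·U(∂p)` EXACTLY with the TRANSPORTED PRODUCT `T = h₁ · U₁h₂U₁⁻¹ · (U₁U₂U₃⁻¹)h₃⁻¹(U₁U₂U₃⁻¹)⁻¹ · U(∂p)h₄⁻¹U(∂p)⁻¹`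
  (each translation parallel-transported to the base corner of `p`).
* §2 (`SU(2)`) `wilsonTerm_mul_sub`: `(1 − reTr(T·W)) − (1 − reTr W) = Re((1 − su2Quat T)·su2Quat W)`, and its size `≤ ‖su2Quat T − 1‖`.
* §3 PERFECT FRAMES — when the transported product is a rotation about ONE axis, `T = expPoint(s·n̂)`, `‖n̂‖ = 1`:
  ★★`wilsonTerm_expPoint_mul_sub`: `(1 − reTr(T·W)) − (1 − reTr W) = (1 − cos s)·reTr W + sin s·⟨n̂, imVec(su2Quat W)⟩` — a non-negative COST
  `(1 − cos s)·reTr W` (`≈ s²/2`, `s = Σ ±aᵢ = (da)(p)` for `hᵢ = exp(aᵢ·n̂ᵢ)` with covariantly constant `n̂ᵢ`) plus the TORQUE pairing `n̂` with the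
  plaquette's field-strength vector `imVec(su2Quat W)` — the fine constituent of the card's `(θ/σ²)·Y_n̂`; `cost_nonneg_of_reTr_nonneg`.
* §4 IMPERFECT FRAMES: ★`abs_wilsonTerm_mul_sub_sub_le`: `|Δ_T(W) − Δ_{T₀}(W)| ≤ ‖su2Quat T − su2Quat T₀‖` — the per-plaquette DEFECT is the
  quaternion distance of the actual transported product from the ideal one-axis rotation (frame mismatch × amplitude), to be summed with
  the weights `β_K` in (HGap).

WHAT THIS IS NOT.  Exact algebra on one plaquette: no sweep, frames, averaging response or budget; nothing of (HGap), `stub_unboundedDepth`,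
`HistoryTailL`, the rung R3, d = 4, a continuum limit or a mass gap is proved.  YM₃ on T³ is rung R3, NOT Clay.  Folklore throughout.
-/

noncomputable section

open scoped Quaternion RealInnerProductSpace
open Literature.MathematicalPhysics.QuantumLattice (su2Quat norm_su2Quat abs_re_le_norm)
open Literature.MathematicalPhysics.QuantumFieldTheory.Balaban1983to89
open Literature.MathematicalPhysics.QuantumFieldTheory.Balaban1983to89.T4HaarSU2Translate (su2Quat_mul su2Quat_one)
open Literature.MathematicalPhysics.QuantumFieldTheory.Balaban1983to89.T4CubeChartGnomonic (SU2)
open Literature.MathematicalPhysics.QuantumFieldTheory.Balaban1983to89.T4HaarSU2ExpChart (imQuat expPoint)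
open Literature.MathematicalPhysics.QuantumFieldTheory.Balaban1983to89.T4ExpWindowSmallField (imVec)
open Literature.MathematicalPhysics.QuantumFieldTheory.Balaban1983to89.T4GnomonicWilsonHessian (reTr_eq_re_su2Quat)
open Literature.MathematicalPhysics.QuantumFieldTheory.Balaban1983to89.T4WilsonLinkAffine (bond₁ bond₂ bond₃ bond₄)
open Summit.QuantumFields.YangMills.Theorems.CovariantDischargeOneLinkIncrement (su2Quat_expPoint_smul re_imQuat_mul)

namespace Summit.QuantumFields.YangMills.Theorems.CovariantDischargePlaquetteTransport

/-! ## §1 The transported product (any gauge group) -/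

section AnyGroup

variable {P : Params} {j : ℕ} {G : Type*} [GaugeGroup G]

/-- **PLAQUETTE TRANSPORT FORMULA.**  If the four letters of `∂p` are left-translated, `U′(bᵢ) = hᵢ·U(bᵢ)` (`i = 1,…,4`; nothing is assumed
off `∂p`), then `U′(∂p) = T·U(∂p)` with `T = h₁ · U₁h₂U₁⁻¹ · (U₁U₂U₃⁻¹)h₃⁻¹(U₁U₂U₃⁻¹)⁻¹ · U(∂p)h₄⁻¹U(∂p)⁻¹`: every translation transported
to the base corner. [folklore] -/
theorem plaqHol_of_mul_left {U U' : GaugeField P j G} (p : Plaq P j) {h₁ h₂ h₃ h₄ : G}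
    (e₁ : U' (bond₁ p) = h₁ * U (bond₁ p)) (e₂ : U' (bond₂ p) = h₂ * U (bond₂ p))
    (e₃ : U' (bond₃ p) = h₃ * U (bond₃ p)) (e₄ : U' (bond₄ p) = h₄ * U (bond₄ p)) :
    GaugeField.plaqHol U' p =
      (h₁ * (U (bond₁ p) * h₂ * (U (bond₁ p))⁻¹) *
        ((U (bond₁ p) * U (bond₂ p) * (U (bond₃ p))⁻¹) * h₃⁻¹ * (U (bond₁ p) * U (bond₂ p) * (U (bond₃ p))⁻¹)⁻¹) *
        (GaugeField.plaqHol U p * h₄⁻¹ * (GaugeField.plaqHol U p)⁻¹)) * GaugeField.plaqHol U p := by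
  have e : GaugeField.plaqHol U' p = U' (bond₁ p) * U' (bond₂ p) * (U' (bond₃ p))⁻¹ * (U' (bond₄ p))⁻¹ := rfl
  have e' : GaugeField.plaqHol U p = U (bond₁ p) * U (bond₂ p) * (U (bond₃ p))⁻¹ * (U (bond₄ p))⁻¹ := rfl
  rw [e, e', e₁, e₂, e₃, e₄]
  group

/-- The same when `U′` IS the fourfold update of `U` on the (pairwise distinct) letters of `∂p`. [folklore] -/
theorem plaqHol_update₄ [DecidableEq (PBond P j)] (U : GaugeField P j G) (p : Plaq P j) (h₁ h₂ h₃ h₄ : G) :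
    GaugeField.plaqHol (Function.update (Function.update (Function.update (Function.update U
        (bond₁ p) (h₁ * U (bond₁ p))) (bond₂ p) (h₂ * U (bond₂ p))) (bond₃ p) (h₃ * U (bond₃ p))) (bond₄ p) (h₄ * U (bond₄ p))) p =
      (h₁ * (U (bond₁ p) * h₂ * (U (bond₁ p))⁻¹) *
        ((U (bond₁ p) * U (bond₂ p) * (U (bond₃ p))⁻¹) * h₃⁻¹ * (U (bond₁ p) * U (bond₂ p) * (U (bond₃ p))⁻¹)⁻¹) *
        (GaugeField.plaqHol U p * h₄⁻¹ * (GaugeField.plaqHol U p)⁻¹)) * GaugeField.plaqHol U p := by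
  have hne := T4WilsonLinkAffine.letters_pairwise_ne p
  refine plaqHol_of_mul_left p ?_ ?_ ?_ ?_
  · rw [Function.update_of_ne hne.2.2.1, Function.update_of_ne hne.2.1, Function.update_of_ne hne.1, Function.update_self]
  · rw [Function.update_of_ne hne.2.2.2.2.1, Function.update_of_ne hne.2.2.2.1, Function.update_self]
  · rw [Function.update_of_ne hne.2.2.2.2.2, Function.update_self]
  · rw [Function.update_self]

end AnyGroup

/-! ## §2 `SU(2)`: the Wilson term of a left-multiplied holonomy -/

section SU2Term

/-- `(1 − reTr(T·W)) − (1 − reTr W) = Re((1 − su2Quat T)·su2Quat W)`. [folklore] -/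
theorem wilsonTerm_mul_sub (T W : SU2) :
    (1 - reTr (T * W)) - (1 - reTr W) = ((1 - su2Quat T) * su2Quat W).re := by
  rw [reTr_eq_re_su2Quat, reTr_eq_re_su2Quat, su2Quat_mul, sub_mul, one_mul, Quaternion.re_sub]
  ring

/-- Size: `|(1 − reTr(T·W)) − (1 − reTr W)| ≤ ‖su2Quat T − 1‖`. [folklore] -/
theorem abs_wilsonTerm_mul_sub_le (T W : SU2) :
    |(1 - reTr (T * W)) - (1 - reTr W)| ≤ ‖su2Quat T - 1‖ := by
  rw [wilsonTerm_mul_sub]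
  refine (abs_re_le_norm _).trans ?_
  rw [norm_mul, norm_su2Quat, mul_one, ← norm_neg, neg_sub]

/-- **IMPERFECT FRAMES — THE DEFECT LETTER**: for two transports `T`, `T₀` of the same plaquette,
`|[(1 − reTr(T·W)) − (1 − reTr W)] − [(1 − reTr(T₀·W)) − (1 − reTr W)]| ≤ ‖su2Quat T − su2Quat T₀‖`. [folklore] -/
theorem abs_wilsonTerm_mul_sub_sub_le (T T₀ W : SU2) :
    |((1 - reTr (T * W)) - (1 - reTr W)) - ((1 - reTr (T₀ * W)) - (1 - reTr W))| ≤ ‖su2Quat T - su2Quat T₀‖ := by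
  rw [wilsonTerm_mul_sub, wilsonTerm_mul_sub, ← Quaternion.re_sub, ← sub_mul]
  refine (abs_re_le_norm _).trans ?_
  rw [norm_mul, norm_su2Quat, mul_one, sub_sub_sub_cancel_left, ← norm_neg, neg_sub]

end SU2Term

/-! ## §3 Perfect frames: the one-axis transport `T = expPoint(s·n̂)` — cost plus torque -/

section OneAxis

/-- **COST/TORQUE SPLIT PER PLAQUETTE**: for a unit direction `n̂` and angle `s`,
`(1 − reTr(expPoint(s·n̂)·W)) − (1 − reTr W) = (1 − cos s)·reTr W + sin s·⟨n̂, imVec(su2Quat W)⟩`. [folklore] -/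
theorem wilsonTerm_expPoint_mul_sub (W : SU2) {n : EuclideanSpace ℝ (Fin 3)} (hn : ‖n‖ = 1) (s : ℝ) :
    (1 - reTr (expPoint (s • n) * W)) - (1 - reTr W) =
      (1 - Real.cos s) * reTr W + Real.sin s * ⟪n, imVec (su2Quat W)⟫ := by
  rw [wilsonTerm_mul_sub, su2Quat_expPoint_smul hn, reTr_eq_re_su2Quat]
  have h1 : ((1 : ℍ) - ((Real.cos s : ℍ) + Real.sin s • imQuat n)) * su2Quat W =
      (1 - Real.cos s) • su2Quat W - Real.sin s • (imQuat n * su2Quat W) := by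
    rw [sub_mul, add_mul, one_mul, smul_mul_assoc, Quaternion.coe_mul_eq_smul, sub_smul, one_smul]
    abel
  rw [h1, Quaternion.re_sub, Quaternion.re_smul, Quaternion.re_smul, re_imQuat_mul, smul_eq_mul, smul_eq_mul]
  ring

/-- The cost is non-negative on a plaquette with `reTr W ≥ 0` (in particular on every small-field plaquette). [folklore] -/
theorem cost_nonneg_of_reTr_nonneg {W : SU2} (hW : 0 ≤ reTr W) (s : ℝ) : 0 ≤ (1 - Real.cos s) * reTr W :=
  mul_nonneg (sub_nonneg.mpr (Real.cos_le_one s)) hW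

/-- The torque is at most the vector part: `|sin s·⟨n̂, imVec(su2Quat W)⟩| ≤ |sin s|·‖imVec(su2Quat W)‖` (`‖n̂‖ = 1`). [folklore] -/
theorem abs_torque_le {W : SU2} {n : EuclideanSpace ℝ (Fin 3)} (hn : ‖n‖ = 1) (s : ℝ) :
    |Real.sin s * ⟪n, imVec (su2Quat W)⟫| ≤ |Real.sin s| * ‖imVec (su2Quat W)‖ := by
  rw [abs_mul]
  refine mul_le_mul_of_nonneg_left ?_ (abs_nonneg _)
  have h := abs_real_inner_le_norm n (imVec (su2Quat W))
  rwa [hn, one_mul] at h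

/-- **PLAQUETTE TRANSPORT WITH PERFECT FRAMES**: if the four letters of `∂p` are left-translated so that the transported product is the
one-axis rotation `expPoint(s·n̂)`, then the plaquette's Wilson term changes by `(1 − cos s)·reTr U(∂p) + sin s·⟨n̂, imVec(su2Quat U(∂p))⟩`. [folklore] -/
theorem wilsonTerm_plaq_of_transport_eq {P : Params} {j : ℕ} {U U' : GaugeField P j SU2} (p : Plaq P j) {h₁ h₂ h₃ h₄ : SU2}
    (e₁ : U' (bond₁ p) = h₁ * U (bond₁ p)) (e₂ : U' (bond₂ p) = h₂ * U (bond₂ p))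
    (e₃ : U' (bond₃ p) = h₃ * U (bond₃ p)) (e₄ : U' (bond₄ p) = h₄ * U (bond₄ p))
    {n : EuclideanSpace ℝ (Fin 3)} (hn : ‖n‖ = 1) {s : ℝ}
    (hT : h₁ * (U (bond₁ p) * h₂ * (U (bond₁ p))⁻¹) *
        ((U (bond₁ p) * U (bond₂ p) * (U (bond₃ p))⁻¹) * h₃⁻¹ * (U (bond₁ p) * U (bond₂ p) * (U (bond₃ p))⁻¹)⁻¹) *
        (GaugeField.plaqHol U p * h₄⁻¹ * (GaugeField.plaqHol U p)⁻¹) = expPoint (s • n)) :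
    (1 - reTr (GaugeField.plaqHol U' p)) - (1 - reTr (GaugeField.plaqHol U p)) =
      (1 - Real.cos s) * reTr (GaugeField.plaqHol U p) + Real.sin s * ⟪n, imVec (su2Quat (GaugeField.plaqHol U p))⟫ := by
  rw [plaqHol_of_mul_left p e₁ e₂ e₃ e₄, hT]
  exact wilsonTerm_expPoint_mul_sub _ hn s

/-- … and with IMPERFECT frames the change differs from the perfect-frame value by at most the defect `‖su2Quat T − su2Quat(expPoint(s·n̂))‖`
of the actual transported product `T`. [folklore] -/
theorem abs_wilsonTerm_plaq_sub_oneAxis_le {P : Params} {j : ℕ} {U U' : GaugeField P j SU2} (p : Plaq P j) {h₁ h₂ h₃ h₄ : SU2}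
    (e₁ : U' (bond₁ p) = h₁ * U (bond₁ p)) (e₂ : U' (bond₂ p) = h₂ * U (bond₂ p))
    (e₃ : U' (bond₃ p) = h₃ * U (bond₃ p)) (e₄ : U' (bond₄ p) = h₄ * U (bond₄ p))
    {n : EuclideanSpace ℝ (Fin 3)} (hn : ‖n‖ = 1) (s : ℝ) :
    |((1 - reTr (GaugeField.plaqHol U' p)) - (1 - reTr (GaugeField.plaqHol U p))) -
        ((1 - Real.cos s) * reTr (GaugeField.plaqHol U p) + Real.sin s * ⟪n, imVec (su2Quat (GaugeField.plaqHol U p))⟫)| ≤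
      ‖su2Quat (h₁ * (U (bond₁ p) * h₂ * (U (bond₁ p))⁻¹) *
          ((U (bond₁ p) * U (bond₂ p) * (U (bond₃ p))⁻¹) * h₃⁻¹ * (U (bond₁ p) * U (bond₂ p) * (U (bond₃ p))⁻¹)⁻¹) *
          (GaugeField.plaqHol U p * h₄⁻¹ * (GaugeField.plaqHol U p)⁻¹)) - su2Quat (expPoint (s • n))‖ := by
  rw [plaqHol_of_mul_left p e₁ e₂ e₃ e₄, ← wilsonTerm_expPoint_mul_sub _ hn s]
  exact abs_wilsonTerm_mul_sub_sub_le _ _ _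

end OneAxis

end Summit.QuantumFields.YangMills.Theorems.CovariantDischargePlaquetteTransport

end
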